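import Mathlib
import Summits.Ventures.PercRepro.TriangleCapThreeTrianglesF
import Summits.Ventures.PercRepro.TriangleCapTwoBelowDiagonalTwelve

/-!
# PercRepro — THE THREE-TRIANGLE CASE OF THE `r = 2` STABILITY FOR EVERY `k ≥ 10` (p3, gen 37; part 67)

Three triangles `u v w`, `a b c`, `x y z` of a `K₄⁻`-free graph (`a ∉ {u, v, w}`, `x ∉ {u, v, w, a, b, c}`) pairwise
share at most one vertex.  Either every triangle of `D` is one of the three — then the intersection pattern is one of
vertex-disjoint / one shared vertex / a path / a windmill (three shared vertices coincide by `K₄⁻`-freeness), each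
settled by its far count (TriangleCapThreeTrianglesB–E) — or a fourth triangle exists, `|T₃| ≥ 24`, and the envelope
pays (`stability_two_of_twentyfour`).

* **`three_triangles_stability_two_of_ten`** — `K₄⁻`-free, `k ≥ 10`, `m ≥ 2k − 3`, three triangles as above ⇒
  `Σ_v d(v)² + 2 (k − 3) ≤ m k`.
Axioms: standard.
-/

namespace PercRepro

namespace TriangleCap

namespace C047

open Finset

variable {V : Type*} [Fintype V] [DecidableEq V]

/-- Two triangles of a `K₄⁻`-free graph, the second not contained in the first, share at most one vertex. -/
theorem inter_card_le_one_of_triangles (D : SimpleGraph V) [DecidableRel D.Adj] (hK : K4mFree D) {u v w a b c : V}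
    (huv : D.Adj u v) (huw : D.Adj u w) (hvw : D.Adj v w) (hab : D.Adj a b) (hac : D.Adj a c) (hbc : D.Adj b c)
    (ha : ¬ (a = u ∨ a = v ∨ a = w)) : (({u, v, w} : Finset V) ∩ {a, b, c}).card ≤ 1 := by
  apply card_le_one.mpr
  intro p hp q hq
  rw [mem_inter] at hp hq
  simp only [mem_insert, mem_singleton] at hp hq
  exact shared_unique' D hK huv huw hvw hab hac hbc ha hp hq

omit [Fintype V] [DecidableEq V] in
/-- A set of cardinality at most one is empty or a singleton. -/
theorem eq_empty_or_singleton_of_card_le_one {A : Finset V} (h : A.card ≤ 1) : A = ∅ ∨ ∃ t, A = {t} := by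
  rcases Nat.le_one_iff_eq_zero_or_eq_one.mp h with h0 | h1
  · exact Or.inl (card_eq_zero.mp h0)
  · exact Or.inr (card_eq_one.mp h1)

/-- Three shared vertices of three pairwise vertex-sharing triangles of a `K₄⁻`-free graph coincide. -/
theorem shared_eq_of_three (D : SimpleGraph V) [DecidableRel D.Adj] (hK : K4mFree D) {T₁ T₂ T₃ : Finset V}
    (h₁ : T₁.card = 3) (hcl₁ : ∀ x ∈ T₁, ∀ y ∈ T₁, x ≠ y → D.Adj x y)
    (hcl₂ : ∀ x ∈ T₂, ∀ y ∈ T₂, x ≠ y → D.Adj x y) (hcl₃ : ∀ x ∈ T₃, ∀ y ∈ T₃, x ≠ y → D.Adj x y)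
    {t t' t'' : V} (h12 : T₁ ∩ T₂ = {t}) (h13 : T₁ ∩ T₃ = {t'}) (h23 : T₂ ∩ T₃ = {t''}) : t = t' ∧ t = t'' := by
  have ht1 : t ∈ T₁ := (mem_inter.mp (by rw [h12]; exact mem_singleton_self t)).1
  have ht2 : t ∈ T₂ := (mem_inter.mp (by rw [h12]; exact mem_singleton_self t)).2
  have ht'1 : t' ∈ T₁ := (mem_inter.mp (by rw [h13]; exact mem_singleton_self t')).1
  have ht'3 : t' ∈ T₃ := (mem_inter.mp (by rw [h13]; exact mem_singleton_self t')).2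
  have ht''2 : t'' ∈ T₂ := (mem_inter.mp (by rw [h23]; exact mem_singleton_self t'')).1
  have ht''3 : t'' ∈ T₃ := (mem_inter.mp (by rw [h23]; exact mem_singleton_self t'')).2
  have hin12 : ∀ x, x ∈ T₁ → x ∈ T₂ → x = t := fun x a b => by
    have : x ∈ T₁ ∩ T₂ := mem_inter.mpr ⟨a, b⟩
    rwa [h12, mem_singleton] at this
  have hin13 : ∀ x, x ∈ T₁ → x ∈ T₃ → x = t' := fun x a b => by
    have : x ∈ T₁ ∩ T₃ := mem_inter.mpr ⟨a, b⟩
    rwa [h13, mem_singleton] at this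
  have hin23 : ∀ x, x ∈ T₂ → x ∈ T₃ → x = t'' := fun x a b => by
    have : x ∈ T₂ ∩ T₃ := mem_inter.mpr ⟨a, b⟩
    rwa [h23, mem_singleton] at this
  by_cases htt' : t = t'
  · subst htt'
    exact ⟨rfl, hin23 t ht2 ht'3⟩
  · exfalso
    -- `t, t'` are two vertices of `T₁`; `t''` is adjacent to both (or equal to one), closing a second triangle on `t t'`
    have htt'' : t'' ≠ t := fun h => htt' (hin13 t ht1 (h ▸ ht''3))
    have ht't'' : t'' ≠ t' := fun h => htt' (hin12 t' ht'1 (h ▸ ht''2)).symm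
    have hadj : D.Adj t t' := hcl₁ t ht1 t' ht'1 htt'
    have hadj1 : D.Adj t t'' := hcl₂ t ht2 t'' ht''2 (Ne.symm htt'')
    have hadj2 : D.Adj t' t'' := hcl₃ t' ht'3 t'' ht''3 (Ne.symm ht't'')
    -- the third vertex `s` of `T₁` is the unique common neighbour of `t, t'`
    obtain ⟨s, hs, hts, ht's⟩ := exists_third_of_clique D h₁ hcl₁ ht1 ht'1 htt'
    have := eq_of_common_nbr D hK hadj hts ht's hadj1 hadj2
    subst this
    exact htt'' (hin12 s hs ht''2)

/-- **THE THREE-TRIANGLE CASE OF THE `r = 2` STABILITY, `k ≥ 10`, `m ≥ 2k − 3`.** -/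
theorem three_triangles_stability_two_of_ten (D : SimpleGraph V) [DecidableRel D.Adj] (hK : K4mFree D)
    (hk : 10 ≤ Fintype.card V) (hm : 2 * Fintype.card V ≤ D.edgeFinset.card + 3) {u v w a b c x y z : V}
    (huv : D.Adj u v) (huw : D.Adj u w) (hvw : D.Adj v w) (hab : D.Adj a b) (hac : D.Adj a c) (hbc : D.Adj b c)
    (hxy : D.Adj x y) (hxz : D.Adj x z) (hyz : D.Adj y z)
    (ha : ¬ (a = u ∨ a = v ∨ a = w)) (hx : ¬ (x = u ∨ x = v ∨ x = w ∨ x = a ∨ x = b ∨ x = c)) :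
    ∑ v, deg D v * deg D v + 2 * (Fintype.card V - 3) ≤ D.edgeFinset.card * Fintype.card V := by
  set T₁ : Finset V := {u, v, w} with hT₁
  set T₂ : Finset V := {a, b, c} with hT₂
  set T₃ : Finset V := {x, y, z} with hT₃
  have h₁ : T₁.card = 3 := card_triple huv.ne huw.ne hvw.ne
  have h₂ : T₂.card = 3 := card_triple hab.ne hac.ne hbc.ne
  have h₃ : T₃.card = 3 := card_triple hxy.ne hxz.ne hyz.ne
  have hcl₁ := clique_triple D huv huw hvw
  have hcl₂ := clique_triple D hab hac hbc
  have hcl₃ := clique_triple D hxy hxz hyz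
  have hone₁ : ∀ z', z' ∉ T₁ → degIn D T₁ z' ≤ 1 := fun z' hz => degIn_le_one_of_triangle D hK huv huw hvw hz
  have hone₂ : ∀ z', z' ∉ T₂ → degIn D T₂ z' ≤ 1 := fun z' hz => degIn_le_one_of_triangle D hK hab hac hbc hz
  have hone₃ : ∀ z', z' ∉ T₃ → degIn D T₃ z' ≤ 1 := fun z' hz => degIn_le_one_of_triangle D hK hxy hxz hyz hz
  have hx1 : ¬ (x = u ∨ x = v ∨ x = w) := fun h => hx (by tauto)
  have hx2 : ¬ (x = a ∨ x = b ∨ x = c) := fun h => hx (by tauto)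
  have hi12 : (T₁ ∩ T₂).card ≤ 1 := inter_card_le_one_of_triangles D hK huv huw hvw hab hac hbc ha
  have hi13 : (T₁ ∩ T₃).card ≤ 1 := inter_card_le_one_of_triangles D hK huv huw hvw hxy hxz hyz hx1
  have hi23 : (T₂ ∩ T₃).card ≤ 1 := inter_card_le_one_of_triangles D hK hab hac hbc hxy hxz hyz hx2
  by_cases hT : ∀ x' y' z', D.Adj x' y' → D.Adj x' z' → D.Adj y' z' →
      (x' ∈ T₁ ∧ y' ∈ T₁) ∨ (x' ∈ T₂ ∧ y' ∈ T₂) ∨ (x' ∈ T₃ ∧ y' ∈ T₃)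
  · -- every triangle is one of the three: the intersection pattern
    rcases eq_empty_or_singleton_of_card_le_one hi12 with e12 | ⟨t, e12⟩ <;>
      rcases eq_empty_or_singleton_of_card_le_one hi13 with e13 | ⟨t', e13⟩ <;>
      rcases eq_empty_or_singleton_of_card_le_one hi23 with e23 | ⟨t'', e23⟩
    · -- disjoint
      exact three_triangles_stability_two_of_disjoint D hK hk T₁ T₂ T₃ h₁ h₂ h₃
        (disjoint_iff_inter_eq_empty.mpr e12) (disjoint_iff_inter_eq_empty.mpr e13)
        (disjoint_iff_inter_eq_empty.mpr e23) hcl₁ hcl₂ hcl₃ hone₁ hone₂ hone₃ hT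
    · -- `T₂ ∩ T₃ = {t''}` only: one shared vertex, `(T₂, T₃, T₁)`
      exact three_triangles_stability_two_of_one_shared D hK (by omega) T₂ T₃ T₁ h₂ h₃ h₁ e23
        (disjoint_iff_inter_eq_empty.mpr (by rw [inter_comm]; exact e12))
        (disjoint_iff_inter_eq_empty.mpr (by rw [inter_comm]; exact e13)) hcl₂ hcl₃ hcl₁ hone₂ hone₃ hone₁
        (fun x' y' z' h1 h2 h3 => by
          rcases hT x' y' z' h1 h2 h3 with h | h | h
          · exact Or.inr (Or.inr h)
          · exact Or.inl h
          · exact Or.inr (Or.inl h))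
    · -- `T₁ ∩ T₃ = {t'}` only: `(T₁, T₃, T₂)`
      exact three_triangles_stability_two_of_one_shared D hK (by omega) T₁ T₃ T₂ h₁ h₃ h₂ e13
        (disjoint_iff_inter_eq_empty.mpr e12)
        (disjoint_iff_inter_eq_empty.mpr (by rw [inter_comm]; exact e23)) hcl₁ hcl₃ hcl₂ hone₁ hone₃ hone₂
        (fun x' y' z' h1 h2 h3 => by
          rcases hT x' y' z' h1 h2 h3 with h | h | h
          · exact Or.inl h
          · exact Or.inr (Or.inr h)
          · exact Or.inr (Or.inl h))
    · -- `T₁ ∩ T₃ = {t'}`, `T₂ ∩ T₃ = {t''}`: a path with middle `T₃`, `(T₁, T₃, T₂)`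
      exact three_triangles_stability_two_of_path D hK (by omega) T₁ T₃ T₂ h₁ h₃ h₂ e13
        (by rw [inter_comm]; exact e23) (disjoint_iff_inter_eq_empty.mpr e12) hcl₁ hcl₃ hcl₂ hone₁ hone₃ hone₂
        (fun x' y' z' h1 h2 h3 => by
          rcases hT x' y' z' h1 h2 h3 with h | h | h
          · exact Or.inl h
          · exact Or.inr (Or.inr h)
          · exact Or.inr (Or.inl h))
    · -- `T₁ ∩ T₂ = {t}` only: `(T₁, T₂, T₃)`
      exact three_triangles_stability_two_of_one_shared D hK (by omega) T₁ T₂ T₃ h₁ h₂ h₃ e12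
        (disjoint_iff_inter_eq_empty.mpr e13) (disjoint_iff_inter_eq_empty.mpr e23) hcl₁ hcl₂ hcl₃
        hone₁ hone₂ hone₃ hT
    · -- `T₁ ∩ T₂ = {t}`, `T₂ ∩ T₃ = {t''}`: a path with middle `T₂`
      exact three_triangles_stability_two_of_path D hK (by omega) T₁ T₂ T₃ h₁ h₂ h₃ e12 e23
        (disjoint_iff_inter_eq_empty.mpr e13) hcl₁ hcl₂ hcl₃ hone₁ hone₂ hone₃ hT
    · -- `T₁ ∩ T₂ = {t}`, `T₁ ∩ T₃ = {t'}`: a path with middle `T₁`, `(T₂, T₁, T₃)`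
      exact three_triangles_stability_two_of_path D hK (by omega) T₂ T₁ T₃ h₂ h₁ h₃
        (by rw [inter_comm]; exact e12) e13 (disjoint_iff_inter_eq_empty.mpr e23) hcl₂ hcl₁ hcl₃
        hone₂ hone₁ hone₃
        (fun x' y' z' h1 h2 h3 => by
          rcases hT x' y' z' h1 h2 h3 with h | h | h
          · exact Or.inr (Or.inl h)
          · exact Or.inl h
          · exact Or.inr (Or.inr h))
    · -- three shared vertices: the windmill
      obtain ⟨htt', htt''⟩ := shared_eq_of_three D hK h₁ hcl₁ hcl₂ hcl₃ e12 e13 e23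
      subst htt'
      subst htt''
      exact three_triangles_stability_two_of_windmill D hK (by omega) hm T₁ T₂ T₃ h₁ h₂ h₃ e12 e13 e23
        hcl₁ hcl₂ hcl₃ hone₁ hone₂ hone₃ hT
  · -- a fourth triangle: `|T₃| ≥ 24`
    simp only [not_forall, not_or] at hT
    obtain ⟨x', y', z', hxy', hxz', hyz', h1, h2, h3⟩ := hT
    set T₄ : Finset V := {x', y', z'} with hT₄
    have hx'4 : x' ∈ T₄ := by rw [hT₄]; exact mem_insert_self _ _
    have hy'4 : y' ∈ T₄ := by rw [hT₄]; exact mem_insert_of_mem (mem_insert_self _ _)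
    have hne1 : T₄ ≠ T₁ := fun h => h1 ⟨h ▸ hx'4, h ▸ hy'4⟩
    have hne2 : T₄ ≠ T₂ := fun h => h2 ⟨h ▸ hx'4, h ▸ hy'4⟩
    have hne3 : T₄ ≠ T₃ := fun h => h3 ⟨h ▸ hx'4, h ▸ hy'4⟩
    have hne12 : T₁ ≠ T₂ := fun h => by rw [h, inter_self, h₂] at hi12; omega
    have hne13 : T₁ ≠ T₃ := fun h => by rw [h, inter_self, h₃] at hi13; omega
    have hne23 : T₂ ≠ T₃ := fun h => by rw [h, inter_self, h₃] at hi23; omega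
    have hF : ({T₁, T₂, T₃, T₄} : Finset (Finset V)).card = 4 := by
      rw [card_insert_of_notMem, card_insert_of_notMem, card_insert_of_notMem, card_singleton]
      · rw [mem_singleton]; exact Ne.symm hne3
      · rw [mem_insert, mem_singleton, not_or]; exact ⟨hne23, Ne.symm hne2⟩
      · rw [mem_insert, mem_insert, mem_singleton, not_or, not_or]; exact ⟨hne12, hne13, Ne.symm hne1⟩
    have h24 := six_mul_card_le_card_triangles3 D {T₁, T₂, T₃, T₄} (by
      intro T hT
      simp only [mem_insert, mem_singleton] at hT
      rcases hT with rfl | rfl | rfl | rfl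
      · exact ⟨u, v, w, huv, huw, hvw, rfl⟩
      · exact ⟨a, b, c, hab, hac, hbc, rfl⟩
      · exact ⟨x, y, z, hxy, hxz, hyz, rfl⟩
      · exact ⟨x', y', z', hxy', hxz', hyz', rfl⟩)
    rw [hF] at h24
    exact stability_two_of_twentyfour D hK (by omega) h24

end C047

end TriangleCap

end PercRepro
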